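import Mathlib.RingTheory.Ideal.Operations
import Mathlib.RingTheory.Coprime.Ideal
import Mathlib.Tactic.LinearCombination
import HarnessLib

/-!
# Elements from a coprime factorisation `I·J ⊆ (q)`: `ε ∈ I` with `1 − ε ∈ J`, `x = x·ε + q·c` on `I`, and `a^d·ε = q·c′`

Topic `Literature/RingTheory/Ideal`; namespace `Literature.RingTheory.Ideal.CoprimeDecomposition`.  THEOREMS ONLY, pure commutative algebra over
any commutative ring (no definition, no named fact, no instance, no notation, no `sorry`).  Cell `hodgecm-mathlib` (D-0151), FLOOR 0, P6 «MOD
programme» (crux hLiu418 = stmt-HodgeConjecture-24832, `--supports`, count-neutral): organ **(O-δ) «MULT-BLOCK ∕ FROB₀-UNIT», part 3 «CRT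
ELEMENTS»** — the ring-theoretic bookkeeping that produces the hypotheses (D) `π₀ = π₀·ε + q·c`, `a^d·ε = q·c′` of ★
`GroupSchemes/FrobeniusKernelInclusionAssembly` from the SHAPE of the Frobenius ideal of the CM factor `A₀` (HEART-FROB v4.1 §0: «`(π₀) = w^{d_w}·banal`,
`π₀` a unit at the étale places»): with `I := ∏_{u mult} u^{v_u(q)}` (the multiplicative places of `A₀` over `p`), `J := ∏_{u ét} u^{v_u(q)}` (the étale
ones), `I + J = (1)`, `I·J = (q)`, and `K := ∏_{u ét} u` (`K^d ⊆ J` for `d ≥ max v_u(q)`, `K + I = (1)`), the Chinese remainder theorem gives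
`ε ∈ I` with `1 − ε ∈ J` and `a ∈ K` with `1 − a ∈ I`; then every `x ∈ I` (in particular `π₀` and every element of `(π₀) = 𝔭_w^{d_w}·𝔟 ⊆ I`) satisfies
`x(1 − ε) ∈ I·J ⊆ (q)`, i.e. `x = x·ε + q·c`, and `a^d·ε ∈ J·I ⊆ (q)`, i.e. `a^d·ε = q·c′`; `a` vanishes exactly at the étale places over `p`
(`1 − a ∈ I`), so `A₀[a]` is étale.  HC_CM is proved only modulo the printed citations until rung 0 closes; this file is generic and changes no count.

THE MATHEMATICS ([AtiyahMacdonald1969] Prop. 1.10 (coprime ideals: `I + J = (1) ⟹ I ∩ J = IJ`, and the Chinese remainder theorem Prop. 1.10 (ii)∕(iii));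
[Neukirch1999] Ch. I §3 (3.6) for Dedekind domains): if `I + J = (1)` pick `ε ∈ I`, `j ∈ J` with `ε + j = 1`; then `1 − ε = j ∈ J`, and for
`x ∈ I`, `x − xε = x·j ∈ IJ`.  Nothing beyond the definitions is used (any commutative ring).

* `exists_mem_and_one_sub_mem_of_isCoprime`, `exists_eq_mul_add_mul_of_mem`, `exists_pow_mul_eq_mul_of_mem`, **`exists_decomposition_elements`**.

## References
* [AtiyahMacdonald1969] M. F. Atiyah, I. G. Macdonald, *Introduction to Commutative Algebra* (1969), Prop. 1.10 (p. 7) (coprime ideals, CRT).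
* [Neukirch1999] J. Neukirch, *Algebraic Number Theory* (1999), Ch. I §3, Thm. (3.6) (Chinese remainder theorem in Dedekind domains).
-/

set_option autoImplicit false

namespace Literature.RingTheory.Ideal.CoprimeDecomposition

variable {R : Type*} [CommRing R]

/-- CRT, element form: coprime ideals `I + J = (1)` have an `ε ∈ I` with `1 − ε ∈ J`. [cite: AtiyahMacdonald1969, Prop. 1.10 (p. 7)] -/
theorem exists_mem_and_one_sub_mem_of_isCoprime {I J : Ideal R} (h : IsCoprime I J) :
    ∃ ε : R, ε ∈ I ∧ 1 - ε ∈ J := by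
  obtain ⟨i, hi, j, hj, hij⟩ := (Ideal.isCoprime_iff_exists.mp h)
  exact ⟨i, hi, by rw [← hij, add_sub_cancel_left]; exact hj⟩

/-- If `I·J ⊆ (q)` and `1 − ε ∈ J`, every `x ∈ I` decomposes as `x = x·ε + q·c` (`x(1 − ε) ∈ IJ ⊆ (q)`).  With `I` the multiplicative part of
`(q)` in `𝒪_F` this is hypothesis (D) «`π₀ = π₀ε + qc`» of ★ `FrobeniusKernelInclusionAssembly` for every `x ∈ (π₀) ⊆ I`.
[cite: AtiyahMacdonald1969, Prop. 1.10 (p. 7)] -/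
theorem exists_eq_mul_add_mul_of_mem {I J : Ideal R} {q ε : R} (hq : I * J ≤ Ideal.span {q}) (hε : 1 - ε ∈ J)
    {x : R} (hx : x ∈ I) : ∃ c : R, x = x * ε + q * c := by
  have hmem : x * (1 - ε) ∈ Ideal.span {q} := hq (Ideal.mul_mem_mul hx hε)
  obtain ⟨c, hc⟩ := Ideal.mem_span_singleton'.mp hmem
  refine ⟨c, ?_⟩
  rw [mul_comm c q] at hc
  linear_combination -hc

/-- If `I·J ⊆ (q)`, `ε ∈ I`, `K^d ⊆ J` and `a ∈ K`, then `a^d·ε = q·c′` for some `c′` (`a^d ε ∈ JI ⊆ (q)`) — hypothesis (D′) of ★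
`FrobeniusKernelInclusionAssembly.kerι_relFrobeniusHom_comp_i_eq_one_of_etale_ker`. [cite: AtiyahMacdonald1969, Prop. 1.10 (p. 7)] -/
theorem exists_pow_mul_eq_mul_of_mem {I J K : Ideal R} {q ε a : R} {d : ℕ} (hq : I * J ≤ Ideal.span {q}) (hε : ε ∈ I)
    (hK : K ^ d ≤ J) (ha : a ∈ K) : ∃ c' : R, a ^ d * ε = q * c' := by
  have had : a ^ d ∈ J := hK (Ideal.pow_mem_pow ha d)
  have hmem : ε * a ^ d ∈ Ideal.span {q} := hq (Ideal.mul_mem_mul hε had)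
  obtain ⟨c', hc'⟩ := Ideal.mem_span_singleton'.mp hmem
  exact ⟨c', by rw [mul_comm (a ^ d) ε, ← hc', mul_comm c' q]⟩

/-- **CRT ELEMENTS for the Frobenius-kernel inclusion.**  In any commutative ring: `I`, `J` coprime with `I·J ⊆ (q)`, `K` coprime to `I` with
`K^d ⊆ J`.  Then there are `ε ∈ I` with `1 − ε ∈ J`, `a ∈ K` with `1 − a ∈ I`, and `c′` with `a^d·ε = q·c′`, and every `x ∈ I` decomposes as
`x = x·ε + q·c`.  (Heart: `I`∕`J` = multiplicative∕étale parts of `(q) = (p^f)` in `𝒪_F` for the CM factor `A₀`, `K` = the product of the étale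
primes; `π₀ ∈ (π₀) = 𝔭_w^{d_w}𝔟 ⊆ I`; `a ≡ 0` at the étale places and `≡ 1` at the multiplicative ones, so `A₀[a]` is étale.)
[cite: AtiyahMacdonald1969, Prop. 1.10 (p. 7)] [cite: Neukirch1999, Ch. I §3, Thm. (3.6)] -/
theorem exists_decomposition_elements {I J K : Ideal R} {q : R} {d : ℕ} (hIJ : IsCoprime I J) (hq : I * J ≤ Ideal.span {q})
    (hK : K ^ d ≤ J) (hKI : IsCoprime K I) :
    ∃ ε a c' : R, ε ∈ I ∧ 1 - ε ∈ J ∧ a ∈ K ∧ 1 - a ∈ I ∧ a ^ d * ε = q * c' ∧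
      ∀ x ∈ I, ∃ c : R, x = x * ε + q * c := by
  obtain ⟨ε, hεI, hεJ⟩ := exists_mem_and_one_sub_mem_of_isCoprime hIJ
  obtain ⟨a, haK, haI⟩ := exists_mem_and_one_sub_mem_of_isCoprime hKI
  obtain ⟨c', hc'⟩ := exists_pow_mul_eq_mul_of_mem hq hεI hK haK
  exact ⟨ε, a, c', hεI, hεJ, haK, haI, hc', fun x hx => exists_eq_mul_add_mul_of_mem hq hεJ hx⟩

end Literature.RingTheory.Ideal.CoprimeDecomposition
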